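import Mathlib
import Summits.KontsevichZagierPeriods.Zeta5Search.ClassFloorFacts
import Summits.KontsevichZagierPeriods.Zeta5Search.ClusterValuationPairs
import HarnessLib

/-!
# ζ(5) search — LEMMA V1 (`ClassExpLowerBound`) and LEMMA V2's floor bound (`SinglePoleExpBound`) are THEOREMS

Cell `pub-zeta5` (HONEST FRAMING: systematic search; no irrationality claim unless certified), typer seat
generation 8.  Discharges BY NAME two statements of gen-2 g8's `V`-floor mechanism (`Zeta5Search/ClusterValuationPairs.lean`
§3b; REPORT-gen2-g8 §2.2, Lemma V1 and Lemma V2; exact checks there: 18,695 multipole classes / 4.49·10⁶ exhaustive):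

* `classExpLowerBound_holds : ClassExpLowerBound` — a class with at least two poles has `E_x ≥ −(N_p + 1)`;
* `singlePoleExpBound_holds : SinglePoleExpBound` — a single-pole class with a neutral point below its pole has
  `netExp(q) ≥ −N_p`.

PROOF (g7's floor facts, `ClassFloorFacts.lean`): with `j₁` a largest block and `j₂` a largest block among the others, every
pole lies in `B_{j₁} ∩ B_{j₂}`; `E_x ≥ #class − Σ_j nB j`; (F1) bounds `nB j₂` by `N_{j₁j₂} + 1` and forces `N_{j₁k} ≥ 1` for
every further met block, (F2) bounds `nB k − 1` by `N_{j₂k}`; the two stars of `j₁`, `j₂` fit under `N_p`.  For the single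
pole: the neutral point and the pole both lie in `B_{j₁}`, so (F1) gives a unit `N_{j₁k} ≥ 1` for each of the `depth(q) − 1`
other blocks through `q`.  Only `p ≥ 1` and the polytope are used.  Integer bookkeeping; nothing about irrationality.
-/

noncomputable section

open Finset

namespace Summit.KontsevichZagierPeriods.Zeta5Search.ClusterValuation

open Summit.KontsevichZagierPeriods.Zeta5Search.DualSeries (InBox)
open Summit.KontsevichZagierPeriods.Zeta5Search.CasoratianValuation (InPolytope pairFloors)

/-! ### Nested blocks -/

/-- Blocks are nested by their lower parameters. -/
theorem blk_subset_blk (b : ℕ → ℤ) (hb : InBox b) {i k : ℕ} (hi : i < 7) (hk : k < 7) (hik : b (i + 1) ≤ b (k + 1)) :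
    blk b k ⊆ blk b i := by
  intro s hs
  rw [mem_blk] at hs ⊢
  have h1 := (hb.2 i (mem_range.2 hi)).1
  have h2 := (hb.2 k (mem_range.2 hk)).1
  have : (b (i + 1)).toNat ≤ (b (k + 1)).toNat := by omega
  omega

/-- Hence the class/block counts are monotone. -/
theorem nB_mono (b : ℕ → ℤ) (hb : InBox b) (p x : ℕ) {i k : ℕ} (hi : i < 7) (hk : k < 7) (hik : b (i + 1) ≤ b (k + 1)) :
    nB b p x k ≤ nB b p x i :=
  card_le_card (monotone_filter_right _ fun _ _ hs => blk_subset_blk b hb hi hk hik hs)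

/-- A largest block and a largest among the rest. -/
theorem exists_two_largest (b : ℕ → ℤ) :
    ∃ j₁ ∈ range 7, ∃ j₂ ∈ (range 7).erase j₁,
      (∀ k ∈ range 7, b (j₁ + 1) ≤ b (k + 1)) ∧ (∀ k ∈ (range 7).erase j₁, b (j₂ + 1) ≤ b (k + 1)) := by
  obtain ⟨j₁, hj₁, hmin₁⟩ := exists_min_image (range 7) (fun j => b (j + 1)) ⟨0, by simp⟩
  have hne : ((range 7).erase j₁).Nonempty := by
    rcases Nat.eq_zero_or_pos j₁ with h | h
    · exact ⟨1, mem_erase.2 ⟨by omega, by simp⟩⟩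
    · exact ⟨0, mem_erase.2 ⟨by omega, by simp⟩⟩
  obtain ⟨j₂, hj₂, hmin₂⟩ := exists_min_image ((range 7).erase j₁) (fun j => b (j + 1)) hne
  exact ⟨j₁, hj₁, j₂, hj₂, hmin₁, hmin₂⟩

/-- A position of depth `≥ 1` lies in the largest block. -/
theorem mem_largest_of_blockCount (b : ℕ → ℤ) (hb : InBox b) {j₁ : ℕ} (hj₁ : j₁ ∈ range 7)
    (hmin₁ : ∀ k ∈ range 7, b (j₁ + 1) ≤ b (k + 1)) {s : ℕ} (hs : 1 ≤ blockCount b s) : s ∈ blk b j₁ := by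
  rw [blockCount_eq] at hs
  obtain ⟨j, hj⟩ := card_pos.1 (by omega : 0 < ((range 7).filter fun j => s ∈ blk b j).card)
  rw [mem_filter] at hj
  exact blk_subset_blk b hb (mem_range.1 hj₁) (mem_range.1 hj.1) (hmin₁ j hj.1) hj.2

/-- A position of depth `≥ 2` lies in the largest block among those other than `j₁`. -/
theorem mem_second_of_blockCount (b : ℕ → ℤ) (hb : InBox b) {j₁ j₂ : ℕ} (hj₂ : j₂ ∈ (range 7).erase j₁)
    (hmin₂ : ∀ k ∈ (range 7).erase j₁, b (j₂ + 1) ≤ b (k + 1)) {s : ℕ} (hs : 2 ≤ blockCount b s) : s ∈ blk b j₂ := by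
  rw [blockCount_eq] at hs
  obtain ⟨j, hj, j', hj', hne⟩ := one_lt_card.1 (by omega : 1 < ((range 7).filter fun j => s ∈ blk b j).card)
  rw [mem_filter] at hj hj'
  -- one of `j, j'` differs from `j₁`
  by_cases h : j = j₁
  · have hj'1 : j' ∈ (range 7).erase j₁ := mem_erase.2 ⟨fun e => hne (h.trans e.symm), hj'.1⟩
    exact blk_subset_blk b hb (mem_range.1 (mem_erase.1 hj₂).2) (mem_range.1 hj'.1) (hmin₂ j' hj'1) hj'.2
  · have hj1 : j ∈ (range 7).erase j₁ := mem_erase.2 ⟨h, hj.1⟩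
    exact blk_subset_blk b hb (mem_range.1 (mem_erase.1 hj₂).2) (mem_range.1 hj.1) (hmin₂ j hj1) hj.2

/-- A pole has depth at least `2`. -/
theorem two_le_blockCount_of_pole (b : ℕ → ℤ) {s : ℕ} (hs : netExp b s < 0) : 2 ≤ blockCount b s := by
  unfold netExp at hs; split_ifs at hs <;> omega

/-! ### Lemma V1 -/

/-- **`ClassExpLowerBound` (Lemma V1) is a theorem.** -/
theorem classExpLowerBound_holds : ClassExpLowerBound := by
  intro b p x hb hp5 _hodd _hpb _hwin _hx hcount
  have hbox : InBox b := hb.1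
  have hp : 0 < p := by omega
  obtain ⟨j₁, hj₁, j₂, hj₂, hmin₁, hmin₂⟩ := exists_two_largest b
  have hj₁7 := mem_range.1 hj₁
  have hj₂7 := mem_range.1 (mem_erase.1 hj₂).2
  have hj₂1 : j₂ ≠ j₁ := (mem_erase.1 hj₂).1
  -- two poles ⇒ `nB j₂ ≥ 2`, `nB j₁ ≥ 2`
  obtain ⟨q₁, hq₁, q₂, hq₂, hqne⟩ := one_lt_card.1 (by unfold classPoleCount at hcount; omega :
    1 < ((classSet b p x).filter fun s => netExp b s < 0).card)
  rw [mem_filter] at hq₁ hq₂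
  have hn2 : 2 ≤ nB b p x j₂ := by
    unfold nB
    refine one_lt_card.2 ⟨q₁, mem_filter.2 ⟨hq₁.1, ?_⟩, q₂, mem_filter.2 ⟨hq₂.1, ?_⟩, hqne⟩
    · exact mem_second_of_blockCount b hbox hj₂ hmin₂ (two_le_blockCount_of_pole b hq₁.2)
    · exact mem_second_of_blockCount b hbox hj₂ hmin₂ (two_le_blockCount_of_pole b hq₂.2)
  have hn1 : nB b p x j₂ ≤ nB b p x j₁ := nB_mono b hbox p x hj₁7 hj₂7 (hmin₁ j₂ (mem_erase.1 hj₂).2)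
  -- per-block bounds on `R₁ = range 7 ∖ j₁`
  have hbound : ∀ k ∈ (range 7).erase j₁, (nB b p x k : ℤ) ≤
      (if k = j₂ then 1 else pairTerm b p j₂ k) + pairTerm b p j₁ k := by
    intro k hk
    have hk7 := mem_range.1 (mem_erase.1 hk).2
    by_cases hkj : k = j₂
    · subst hkj
      rw [if_pos rfl]
      have hF1 := floorFact1 (x := x) b hb hp hj₁7 hk7 (by omega) (by omega)
      have : (nB b p x k : ℤ) ≤ nB b p x j₁ := by exact_mod_cast hn1
      linarith
    · rw [if_neg hkj]
      rcases Nat.eq_zero_or_pos (nB b p x k) with h0 | hpos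
      · rw [h0]; push_cast
        have := pairTerm_nonneg b hb p hj₂7 hk7
        have := pairTerm_nonneg b hb p hj₁7 hk7
        linarith
      · have hF2 := floorFact2 b hb hp hj₂7 hk7 (hmin₂ k hk) hpos
        have hF1 := floorFact1 (x := x) b hb hp hj₁7 hk7 (by omega) hpos
        have h1 : (1 : ℤ) ≤ pairTerm b p j₁ k := by
          have : (2 : ℤ) ≤ nB b p x j₁ := by exact_mod_cast le_trans hn2 hn1
          have : (1 : ℤ) ≤ nB b p x k := by exact_mod_cast hpos
          omega
        linarith
  -- sum over `R₁`
  have hsumR : ∑ k ∈ (range 7).erase j₁, (nB b p x k : ℤ) ≤ 1 + pairFloors b p := by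
    have hle := sum_le_sum hbound
    have hsplit : ∑ k ∈ (range 7).erase j₁, ((if k = j₂ then (1 : ℤ) else pairTerm b p j₂ k) + pairTerm b p j₁ k) =
        1 + ∑ k ∈ ((range 7).erase j₁).erase j₂, pairTerm b p j₂ k + ∑ k ∈ (range 7).erase j₁, pairTerm b p j₁ k := by
      rw [sum_add_distrib, ← add_sum_erase _ _ hj₂, if_pos rfl]
      congr 2
      exact sum_congr rfl fun k hk => by rw [if_neg (mem_erase.1 hk).1]
    have hstars := two_stars_le_pairFloors b hb p hj₁7 hj₂7 hj₂1
    linarith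
  -- assemble
  have hC : (nB b p x j₁ : ℤ) ≤ (classSet b p x).card := by
    exact_mod_cast (card_filter_le _ _ : nB b p x j₁ ≤ _)
  have hE := classExp_ge_card_sub b p x
  rw [← add_sum_erase _ _ hj₁] at hE
  linarith

/-! ### Lemma V2's floor bound -/

/-- **`SinglePoleExpBound` is a theorem.** -/
theorem singlePoleExpBound_holds : SinglePoleExpBound := by
  intro b p x q s₀ hb hp5 _hodd _hpb _hwin _hx _hcount hq hqpole hs₀ hs₀q hneut
  have hbox : InBox b := hb.1
  have hp : 0 < p := by omega
  obtain ⟨j₁, hj₁, j₂, _, hmin₁, _⟩ := exists_two_largest b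
  have hj₁7 := mem_range.1 hj₁
  -- both `q` and `s₀` lie in the largest block
  have hq2 := two_le_blockCount_of_pole b hqpole
  have hq1 : q ∈ blk b j₁ := mem_largest_of_blockCount b hbox hj₁ hmin₁ (by omega)
  have hs1 : s₀ ∈ blk b j₁ := by
    refine mem_largest_of_blockCount b hbox hj₁ hmin₁ ?_
    unfold netExp at hneut; split_ifs at hneut <;> omega
  have hn1 : 2 ≤ nB b p x j₁ := by
    unfold nB
    exact one_lt_card.2 ⟨s₀, mem_filter.2 ⟨hs₀, hs1⟩, q, mem_filter.2 ⟨hq, hq1⟩, by omega⟩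
  -- every other block through `q` gives a unit pair floor with `j₁`
  have hunit : ∀ k ∈ ((range 7).erase j₁).filter (fun k => q ∈ blk b k), (1 : ℤ) ≤ pairTerm b p j₁ k := by
    intro k hk
    obtain ⟨hk1, hqk⟩ := mem_filter.1 hk
    have hk7 := mem_range.1 (mem_erase.1 hk1).2
    have hnk : 1 ≤ nB b p x k := by
      unfold nB; exact card_pos.2 ⟨q, mem_filter.2 ⟨hq, hqk⟩⟩
    have hF1 := floorFact1 (x := x) b hb hp hj₁7 hk7 (by omega) hnk
    have : (2 : ℤ) ≤ nB b p x j₁ := by exact_mod_cast hn1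
    have : (1 : ℤ) ≤ nB b p x k := by exact_mod_cast hnk
    omega
  -- count: the blocks through `q` other than `j₁` are `depth(q) − 1`
  have hcount : (((range 7).erase j₁).filter (fun k => q ∈ blk b k)).card = blockCount b q - 1 := by
    rw [blockCount_eq]
    have : ((range 7).erase j₁).filter (fun k => q ∈ blk b k) = ((range 7).filter fun k => q ∈ blk b k).erase j₁ := by
      ext k; simp only [mem_filter, mem_erase]; tauto
    rw [this, card_erase_of_mem (mem_filter.2 ⟨hj₁, hq1⟩)]
  have hstar : ((blockCount b q : ℤ) - 1) ≤ ∑ k ∈ (range 7).erase j₁, pairTerm b p j₁ k := by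
    have h1 : ((blockCount b q : ℤ) - 1) = ∑ k ∈ ((range 7).erase j₁).filter (fun k => q ∈ blk b k), (1 : ℤ) := by
      rw [sum_const, nsmul_eq_mul, mul_one, hcount]; omega
    rw [h1]
    exact (sum_le_sum hunit).trans
      (sum_le_sum_of_subset_of_nonneg (filter_subset _ _) fun k hk _ =>
        pairTerm_nonneg b hb p hj₁7 (mem_range.1 (mem_erase.1 hk).2))
  have hNp : ∑ k ∈ (range 7).erase j₁, pairTerm b p j₁ k ≤ pairFloors b p := by
    have h1 := pairSum_erase b p (mem_range.2 hj₁7 : j₁ ∈ range 7)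
    have h2 := pairSum_nonneg b hb p (S := (range 7).erase j₁) (erase_subset _ _)
    rw [pairSum_range] at h1
    linarith
  unfold netExp
  split_ifs <;> omega

end Summit.KontsevichZagierPeriods.Zeta5Search.ClusterValuation

end
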